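import Literature.Analysis.FluidPDE.KNSSNoAxisymmetricTypeI
import Literature.Analysis.FluidPDE.KNSSTypeIIProofs
import Literature.Analysis.FluidPDE.TaoEnstrophyLocalisationLeaves
import Literature.Analysis.FluidPDE.SereginEpsilonRegularityProofs
import Literature.Barriers.NavierStokesRegularity.AxisymmetricTypeIExclusionProofs
import HarnessLib

/-!
# `knss_no_axisymmetric_typeI`: the assembly refreshed to the reductions now in the tree

Analysis/FluidPDE proofs-layer file (theorems only) on the decomposition path of the named fact
`Literature.Analysis.FluidPDE.knss_no_axisymmetric_typeI` (`Axisymmetric.lean`; Koch–Nadirashvili–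
Seregin–Šverák, Acta Math. 203 (2009) = arXiv:0709.3599, §6: an axisymmetric classical
Leray–Hopf solution on `ℝ³ × [0, T)` with a Type I bound, in the space form `|u| ≤ C/|x'|`
(Thm. 6.1) or in the rate form `|u| ≤ C/√(T - t)` (cf. Thm. 6.2 and Seregin–Šverák 2009,
Thm. 1.1), extends smoothly past `T`).

`KNSSNoAxisymmetricTypeI.lean` proved the fact from six vendored printed results
(`knss_no_axisymmetric_typeI_of_literature`: KNSS Thm. 6.1, RRS Thm. 6.15, Tao 2011 Thm. 5.4,
Seregin–Šverák 2009 Thm. 3.1, Seregin 2014 Ch. 6 Thm. 1.4, Lemarié-Rieusset 2016 Thm. 14.4). Since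
then the tree has acquired proved reductions of several of these inputs; this file composes them,
so that the trust base of the fact is stated (i) over five printed theorems and (ii) over the
named facts that are the current leaves of their printed proofs:

* `hasSmoothExtensionPast_of_bounded_of_leray_regular` — the continuation of bounded classical
  Leray–Hopf solutions (`hasSmoothExtensionPast_of_bounded`, `KNSSTypeII.lean`) from **one** leaf,
  Leray's local regular solutions issued from `H¹` data (`leray_local_regular_H1`,
  `LerayLocalRegularH1.lean`: Leray 1934 §§19–24 = Ożański–Pooley 2018 Thm. 6.30, Cor. 6.16;
  RRS 2016 Thm. 6.15), through `leray_local_strong_H1_of_regular`,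
  `tao2011_H1_local_almost_regular_of_leray` (`TaoEnstrophyLocalisationLeaves.lean`) and
  `hasSmoothExtensionPast_of_bounded_of_local_H1_theory` (`KNSSTypeIIContinuation.lean`);
* `knss_no_axisymmetric_typeI_of_printed` — the fact from FIVE printed theorems: KNSS Thm. 6.1
  (`KNSS2009_regularity_bound_C_over_r`), Leray's local regular `H¹` theory
  (`leray_local_regular_H1`), Seregin–Šverák 2009 Thm. 3.1 (the catalogued barrier
  `AxisymmetricTypeIExclusion`), Seregin 2014 Ch. 6 Thm. 1.4 (`seregin2014_thm14`) and
  Lemarié-Rieusset 2016 Thm. 14.4 (`lemarieRieusset_epsilon_regularity`);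
* `knss_no_axisymmetric_typeI_of_leaves` — the fact from the current leaves: KNSS §4 on a finite
  window (`KNSS2009_regularity_boundedWeak_window`) and KNSS Thm. 5.3
  (`KNSS2009_liouville_bound_C_over_r`), which give Thm. 6.1
  (`KNSS2009_regularity_bound_C_over_r_of_window_of_liouville`, `KNSSTypeIIProofs.lean`) and, with
  Seregin–Šverák's Lemma 3.5 (`SereginSverak2009.ScaledEnergyBound`), the off-axis bound of
  Seregin–Zajaczkowski 2007 (`SereginSverak2009.OffAxisBound`) and the Type I blow-up step of
  SS §4 (`SereginSverak2009.BlowupAlternativeTypeI`), the barrier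
  (`axisymmetricTypeIExclusion_of_leaves`, `AxisymmetricTypeIExclusionProofs.lean`); Leray's
  `H¹` theory; and the Caffarelli–Kohn–Nirenberg package — the local energy estimate
  (`localEnergyEstimate`, RRS (16.13)), the pressure estimate (`pressureEstimate`, RRS Lemma 16.7)
  and the one-scale criterion (`lemarieRieusset_epsilon_regularity`), which give Seregin's
  Thm. 1.4 (`seregin2014_thm14_of_estimates`, `SereginEpsilonRegularityProofs.lean`).

Nothing new is asserted; every statement here is a composition of accepted theorems. Discharging
the nine leaves of `knss_no_axisymmetric_typeI_of_leaves` (each a named fact with its own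
decomposition in the tree) discharges `knss_no_axisymmetric_typeI`.

## References

* G. Koch, N. Nadirashvili, G. Seregin, V. Šverák, *Liouville theorems for the Navier–Stokes
  equations and applications*, Acta Math. 203 (2009) 83–105 = arXiv:0709.3599, §4, Thm. 5.3,
  §6 Thms. 6.1–6.2 (arXiv pp. 8, 10, 11–13). [KochNadirashviliSereginSverak2009]
* G. Seregin, V. Šverák, Comm. PDE 34 (2009) 171–201 = arXiv:0804.1803, Thm. 3.1, Lemma 3.5,
  Prop. 3.7, §4. [SereginSverak2009]
* G. Seregin, *Lecture Notes on Regularity Theory for the Navier–Stokes Equations*, World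
  Scientific 2014, Ch. 6, Thm. 1.4. [Seregin2014]
* P. G. Lemarié-Rieusset, *The Navier–Stokes Problem in the 21st Century*, CRC 2016, Thm. 14.4.
  [LemarieRieusset2016]
* J. C. Robinson, J. L. Rodrigo, W. Sadowski, *The Three-Dimensional Navier–Stokes Equations*,
  CUP 2016, Thm. 6.15, (16.13), Lemma 16.7. [RobinsonRodrigoSadowski2016]
* W. S. Ożański, B. C. Pooley, *Leray's fundamental work on the Navier–Stokes equations: a modern
  review of "Sur le mouvement d'un liquide visqueux emplissant l'espace"*, 2018, Thm. 6.30,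
  Cor. 6.16. [OzanskiPooley2018]
-/

noncomputable section

namespace Literature.Analysis.FluidPDE

open Literature.Barriers.NavierStokesRegularity SereginSverak2009

/-- **Continuation of bounded classical Leray–Hopf solutions from Leray's local regular `H¹`
theory alone.** The named fact `hasSmoothExtensionPast_of_bounded` (a classical solution on
`ℝ³ × [0, T)`, Leray–Hopf on `[0, T)` and bounded on `[0, T) × ℝ³`, extends as a classical
solution past `T`) follows from `leray_local_regular_H1`: that fact projects onto
`leray_local_strong_H1` (`leray_local_strong_H1_of_regular`) and yields Tao's almost regular local
theory (`tao2011_H1_local_almost_regular_of_leray`), the two inputs of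
`hasSmoothExtensionPast_of_bounded_of_local_H1_theory`.
[cite: RobinsonRodrigoSadowski2016, Thm 8.17 with Thms 6.15, 6.10 (PDF pp. 131, 111, 106)] -/
theorem hasSmoothExtensionPast_of_bounded_of_leray_regular (h : leray_local_regular_H1) :
    hasSmoothExtensionPast_of_bounded :=
  hasSmoothExtensionPast_of_bounded_of_local_H1_theory (leray_local_strong_H1_of_regular h)
    (tao2011_H1_local_almost_regular_of_leray h)

/-- **`knss_no_axisymmetric_typeI` from five printed theorems**: KNSS 2009 Thm. 6.1
(`KNSS2009_regularity_bound_C_over_r`), Leray's local regular solutions from `H¹` data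
(`leray_local_regular_H1`, for the continuation of bounded Leray–Hopf solutions), and — for the
boundedness of finite-energy axisymmetric Type I solutions up to the blow-up time
(`axisymmetric_typeI_bounded_of_literature`) — Seregin–Šverák 2009 Thm. 3.1
(`AxisymmetricTypeIExclusion`), Seregin 2014 Ch. 6 Thm. 1.4 (`seregin2014_thm14`) and
Lemarié-Rieusset 2016 Thm. 14.4 (`lemarieRieusset_epsilon_regularity`).
[cite: KochNadirashviliSereginSverak2009, Thms 6.1–6.2 (§6, arXiv pp. 11–13)] -/
theorem knss_no_axisymmetric_typeI_of_printed (h61 : KNSS2009_regularity_bound_C_over_r)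
    (hH1 : leray_local_regular_H1) (hSS : AxisymmetricTypeIExclusion)
    (hSer : seregin2014_thm14) (hLR : lemarieRieusset_epsilon_regularity) :
    knss_no_axisymmetric_typeI :=
  knss_no_axisymmetric_typeI_of_parts h61 (hasSmoothExtensionPast_of_bounded_of_leray_regular hH1)
    (axisymmetric_typeI_bounded_of_literature hSS hSer hLR)

/-- **`knss_no_axisymmetric_typeI` from the current leaves of the printed proofs.** KNSS §4 on
a finite window (`KNSS2009_regularity_boundedWeak_window`) and KNSS Thm. 5.3
(`KNSS2009_liouville_bound_C_over_r`) give Thm. 6.1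
(`KNSS2009_regularity_bound_C_over_r_of_window_of_liouville`); Seregin–Šverák's Lemma 3.5
(`ScaledEnergyBound`), the off-axis bound of Seregin–Zajaczkowski 2007 (`OffAxisBound`), the
Type I blow-up step of SS §4 (`BlowupAlternativeTypeI`) and Thm. 5.3 give the barrier
(`axisymmetricTypeIExclusion_of_leaves`); the CKN local energy and pressure estimates
(`localEnergyEstimate`, `pressureEstimate`) with Lemarié-Rieusset's one-scale criterion give
Seregin's Thm. 1.4 (`seregin2014_thm14_of_estimates`); Leray's `H¹` theory gives the
continuation. Discharging these nine named facts discharges `knss_no_axisymmetric_typeI`.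
[cite: KochNadirashviliSereginSverak2009, Thms 6.1–6.2 (§6, arXiv pp. 11–13) with §4 and Thm 5.3] -/
theorem knss_no_axisymmetric_typeI_of_leaves (hW : KNSS2009_regularity_boundedWeak_window)
    (h53 : KNSS2009_liouville_bound_C_over_r) (hH1 : leray_local_regular_H1)
    (h35 : ScaledEnergyBound) (hoff : OffAxisBound) (h4 : BlowupAlternativeTypeI)
    (hLE : localEnergyEstimate) (hPE : pressureEstimate)
    (hLR : lemarieRieusset_epsilon_regularity) : knss_no_axisymmetric_typeI :=
  knss_no_axisymmetric_typeI_of_printed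
    (KNSS2009_regularity_bound_C_over_r_of_window_of_liouville hW h53) hH1
    (axisymmetricTypeIExclusion_of_leaves h35 hoff h4 h53)
    (seregin2014_thm14_of_estimates hLE hPE hLR) hLR

end Literature.Analysis.FluidPDE

end
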